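import Mathlib.NumberTheory.NumberField.Discriminant.Different
import Mathlib.RingTheory.DedekindDomain.Dvr
import Mathlib.RingTheory.Filtration
import HarnessLib

/-!
# Embeddings of a number field are determined modulo a prime above an unramified `p`

Topic `NumberTheory/NumberFields`; namespace `Literature.NumberTheory.NumberFields`; a *proofs* file
(theorems only, Mathlib-only imports).  For number fields `K`, `L`, a prime `𝔓` of `𝓞 L` above the
rational prime `p`, and `p ∤ disc K`: two field embeddings `φ₁ φ₂ : K →+* L` whose restrictions to `𝓞 K`
are congruent modulo `𝔓` are EQUAL (`ringHom_ext_of_forall_sub_mem_of_not_dvd_discr`); equivalently the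
reduction map `(K →+* L) → (𝓞 K →+* 𝓞 L ⧸ 𝔓)` is injective
(`quotient_comp_mapRingHom_injective_of_not_dvd_discr`).  This is the «`p` unramified in `K`» proviso
under which a CM type (a set of embeddings) can be read off modulo `𝔓` (Shimura 1998 §13.2: the
`ω̃ᵢ` form a basis of `𝔇₀(Ã)` provided `𝔭 ∩ ℚ` is unramified in `F`; Serre–Tate / Casselman readings of
Frobenius through the CM type), and the first step of the splitting
`𝓞 K ⊗ κ(𝔓) ≅ κ(𝔓)^{Hom(K, L)}`.

Proof (Dedekind–Hensel, no Galois closure): `𝔭 := φ₁⁻¹(𝔓) = φ₂⁻¹(𝔓)`; `p ∤ disc K` makes `(𝓞 K)_𝔭`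
formally unramified over `ℤ` (Mathlib `NumberField.not_dvd_discr_iff_forall_mem`); both `φᵢ` extend to
`(𝓞 K)_𝔭 → (𝓞 L)_𝔓` (`IsLocalization.lift`) and agree modulo the maximal ideal, hence modulo all its
powers, whose intersection is zero (Krull, Mathlib `Ideal.iInf_pow_eq_bot_of_isLocalRing`), hence are equal
(Mathlib `Algebra.FormallyUnramified.ext_of_iInf`); so `φ₁ = φ₂` on `𝓞 K` and on its fraction field `K`.
Sibling of the `ℚ̄_p`-valued statement
`Literature.NumberTheory.Automorphic.ringHom_padicAlgCl_ext_of_forall_norm_sub_lt_one`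
(`HilbertPartialHasseWeightShiftingProofs.lean`), same method.

## References
* Standard (Dedekind's discriminant theorem; Hensel / formal unramifiedness); e.g. J. Neukirch,
  *Algebraic Number Theory* (1999), Ch. III (2.12) (ramified ⇔ `𝔭 ∣ 𝔡`), Ch. II (7.1)–(7.5)
  (unramified extensions are determined by their residue extensions). [NeukirchANT1999]
-/

noncomputable section

open NumberField

namespace Literature.NumberTheory.NumberFields

variable {K L : Type*} [Field K] [NumberField K] [Field L] [NumberField L]

/-- **Embeddings congruent modulo a prime above an unramified `p` are equal.**  For number fields `K, L`,
a prime ideal `𝔓` of `𝓞 L` containing the rational prime `p` with `p ∤ disc K`, and two embeddings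
`φ₁ φ₂ : K →+* L` with `φ₁ x ≡ φ₂ x (mod 𝔓)` for every algebraic integer `x ∈ 𝓞 K`: `φ₁ = φ₂`
(unramified local extensions are determined by their residue extensions: `(𝓞 K)_𝔭`, `𝔭 = φᵢ⁻¹ 𝔓`, is
formally unramified over `ℤ` by Dedekind's discriminant theorem, and the two extensions
`(𝓞 K)_𝔭 → (𝓞 L)_𝔓` agree modulo every power of the maximal ideal, Krull).
[cite: NeukirchANT1999, Ch. III (2.12) and Ch. II (7.1)–(7.5)] -/
theorem ringHom_ext_of_forall_sub_mem_of_not_dvd_discr (𝔓 : Ideal (𝓞 L)) [𝔓.IsPrime] {p : ℕ}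
    (hp : p.Prime) (hp𝔓 : (p : 𝓞 L) ∈ 𝔓) (hdisc : ¬ ((p : ℤ) ∣ NumberField.discr K))
    (φ₁ φ₂ : K →+* L) (h : ∀ x : 𝓞 K, RingOfIntegers.mapRingHom φ₁ x - RingOfIntegers.mapRingHom φ₂ x ∈ 𝔓) :
    φ₁ = φ₂ := by
  classical
  set b₁ : 𝓞 K →+* 𝓞 L := RingOfIntegers.mapRingHom φ₁ with hb₁def
  set b₂ : 𝓞 K →+* 𝓞 L := RingOfIntegers.mapRingHom φ₂ with hb₂def
  -- `𝔓 ≠ ⊥` (it contains `p ≠ 0`)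
  have h𝔓0 : 𝔓 ≠ ⊥ := by
    intro h0
    rw [h0, Ideal.mem_bot] at hp𝔓
    exact hp.ne_zero (by exact_mod_cast hp𝔓)
  -- the common prime `𝔭 = φ₁⁻¹ 𝔓 = φ₂⁻¹ 𝔓` of `𝓞 K`
  let 𝔭 : Ideal (𝓞 K) := 𝔓.comap b₁
  haveI h𝔭 : 𝔭.IsPrime := Ideal.IsPrime.comap b₁
  have hmem𝔭 : ∀ x : 𝓞 K, x ∈ 𝔭 ↔ b₁ x ∈ 𝔓 := fun x => Ideal.mem_comap
  have hmem𝔭' : ∀ x : 𝓞 K, x ∈ 𝔭 ↔ b₂ x ∈ 𝔓 := fun x => by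
    rw [hmem𝔭]
    constructor
    · intro h1
      have : b₂ x = b₁ x - (b₁ x - b₂ x) := by ring
      rw [this]
      exact 𝔓.sub_mem h1 (h x)
    · intro h2
      have : b₁ x = (b₁ x - b₂ x) + b₂ x := by ring
      rw [this]
      exact 𝔓.add_mem (h x) h2
  -- `p ∈ 𝔭`, so `(𝓞 K)_𝔭` is formally unramified over `ℤ`
  have hp𝔭 : ((p : ℤ) : 𝓞 K) ∈ 𝔭 := by
    rw [hmem𝔭, Int.cast_natCast, map_natCast]
    exact hp𝔓
  have hpZ : Prime (p : ℤ) := Nat.prime_iff_prime_int.mp hp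
  haveI hunr : Algebra.IsUnramifiedAt ℤ 𝔭 :=
    (NumberField.not_dvd_discr_iff_forall_mem K (𝓞 K) hpZ).mp hdisc 𝔭 h𝔭 hp𝔭
  -- the local rings `A = (𝓞 K)_𝔭`, `B = (𝓞 L)_𝔓`
  set A := Localization.AtPrime 𝔭 with hAdef
  set B := Localization.AtPrime 𝔓 with hBdef
  have hunit : ∀ y : 𝓞 L, y ∉ 𝔓 → IsUnit (algebraMap (𝓞 L) B y) := fun y hy =>
    IsLocalization.map_units B (⟨y, hy⟩ : 𝔓.primeCompl)
  have hunit₁ : ∀ y : 𝔭.primeCompl, IsUnit ((algebraMap (𝓞 L) B).comp b₁ y) := fun y =>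
    hunit _ (fun hy => y.2 ((hmem𝔭 y).2 hy))
  have hunit₂ : ∀ y : 𝔭.primeCompl, IsUnit ((algebraMap (𝓞 L) B).comp b₂ y) := fun y =>
    hunit _ (fun hy => y.2 ((hmem𝔭' y).2 hy))
  let g₁ : A →+* B := IsLocalization.lift (M := 𝔭.primeCompl) hunit₁
  let g₂ : A →+* B := IsLocalization.lift (M := 𝔭.primeCompl) hunit₂
  have hg₁ : ∀ x : 𝓞 K, g₁ (algebraMap (𝓞 K) A x) = algebraMap (𝓞 L) B (b₁ x) := fun x =>
    IsLocalization.lift_eq (M := 𝔭.primeCompl) hunit₁ x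
  have hg₂ : ∀ x : 𝓞 K, g₂ (algebraMap (𝓞 K) A x) = algebraMap (𝓞 L) B (b₂ x) := fun x =>
    IsLocalization.lift_eq (M := 𝔭.primeCompl) hunit₂ x
  let g₁' : A →ₐ[ℤ] B := { g₁ with commutes' := fun n => by simp }
  let g₂' : A →ₐ[ℤ] B := { g₂ with commutes' := fun n => by simp }
  have hg₁' : ∀ a : A, g₁' a = g₁ a := fun a => rfl
  have hg₂' : ∀ a : A, g₂' a = g₂ a := fun a => rfl
  -- Krull: the powers of the maximal ideal of the DVR `B` intersect in `0`
  set I : Ideal B := IsLocalRing.maximalIdeal B with hIdef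
  haveI : IsNoetherianRing B := IsLocalization.isNoetherianRing 𝔓.primeCompl B inferInstance
  have hI : ⨅ n : ℕ, I ^ n = ⊥ :=
    Ideal.iInf_pow_eq_bot_of_isLocalRing I (IsLocalRing.maximalIdeal.isMaximal B).ne_top
  -- `g₁ ≡ g₂` modulo `I`
  have hPI : ∀ y ∈ 𝔓, algebraMap (𝓞 L) B y ∈ I := fun y hy => by
    rw [hIdef, ← Localization.AtPrime.map_eq_maximalIdeal]
    exact Ideal.mem_map_of_mem _ hy
  have hagree : ∀ a : A, Ideal.Quotient.mk I (g₁' a) = Ideal.Quotient.mk I (g₂' a) := by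
    have hext : (Ideal.Quotient.mk I).comp g₁ = (Ideal.Quotient.mk I).comp g₂ := by
      refine IsLocalization.ringHom_ext 𝔭.primeCompl ?_
      ext x
      change Ideal.Quotient.mk I (g₁ (algebraMap (𝓞 K) A x)) =
        Ideal.Quotient.mk I (g₂ (algebraMap (𝓞 K) A x))
      rw [hg₁, hg₂, Ideal.Quotient.eq, ← map_sub]
      exact hPI _ (h x)
    intro a
    rw [hg₁', hg₂']
    exact RingHom.congr_fun hext a
  have hgg : g₁' = g₂' := Algebra.FormallyUnramified.ext_of_iInf I hI hagree
  -- conclude on `𝓞 K` (the localisation map `𝓞 L → B` is injective), then on `K`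
  have hinj : Function.Injective (algebraMap (𝓞 L) B) :=
    IsLocalization.injective B 𝔓.primeCompl_le_nonZeroDivisors
  have hOK : ∀ x : 𝓞 K, b₁ x = b₂ x := fun x => by
    have h1 : g₁' (algebraMap (𝓞 K) A x) = g₂' (algebraMap (𝓞 K) A x) := by rw [hgg]
    rw [hg₁', hg₂', hg₁, hg₂] at h1
    exact hinj h1
  refine IsLocalization.ringHom_ext (nonZeroDivisors (𝓞 K)) (S := K) ?_
  ext x
  have hx := congrArg (fun y : 𝓞 L => (y : L)) (hOK x)
  simpa [hb₁def, hb₂def, RingOfIntegers.mapRingHom_apply] using hx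

/-- **The reduction of embeddings modulo a prime above an unramified `p` is injective**: for number
fields `K, L`, a prime `𝔓 ∋ p` of `𝓞 L` with `p ∤ disc K`, the map `φ ↦ (φ|_{𝓞 K} mod 𝔓)`,
`(K →+* L) → (𝓞 K →+* 𝓞 L ⧸ 𝔓)`, is injective (restatement of
`ringHom_ext_of_forall_sub_mem_of_not_dvd_discr`).
[cite: NeukirchANT1999, Ch. III (2.12) and Ch. II (7.1)–(7.5)] -/
theorem quotient_comp_mapRingHom_injective_of_not_dvd_discr (𝔓 : Ideal (𝓞 L)) [𝔓.IsPrime] {p : ℕ}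
    (hp : p.Prime) (hp𝔓 : (p : 𝓞 L) ∈ 𝔓) (hdisc : ¬ ((p : ℤ) ∣ NumberField.discr K)) :
    Function.Injective
      (fun φ : K →+* L => (Ideal.Quotient.mk 𝔓).comp (RingOfIntegers.mapRingHom φ)) := by
  intro φ₁ φ₂ hφ
  refine ringHom_ext_of_forall_sub_mem_of_not_dvd_discr 𝔓 hp hp𝔓 hdisc φ₁ φ₂ fun x => ?_
  rw [← Ideal.Quotient.eq]
  exact RingHom.congr_fun hφ x

end Literature.NumberTheory.NumberFields

end
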